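import Literature.AnabelianGeometry.EtaleTheta.Discharge.Sec2Prop26Reduction
import Literature.AnabelianGeometry.AbsoluteAnabelian.AbsTopI.CharOpenBasis
import HarnessLib

/-!
# [EtTh] Prop. 2.4 / 2.6 AS TYPED: no extension for profinite conjugations that do not normalise `Π^tp_C`
# (proof-only; the structural reason behind «F-0610's instance form fails at every datum of record»)

S. Mochizuki, *The étale theta function and its Frobenioid-theoretic manifestations*, Publ. RIMS **45** (2009)
[EtTh], §2, Prop. 2.4 p. 38 («any isomorphism of topological groups `Π^tp_{X̲̲_α} ⥲ Π^tp_{X̲̲_β}` … induces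
isomorphisms compatible with the various natural maps between the respective `Π^tp`'s»), Prop. 2.6 p. 40 (the dotted
coverings; «A similar statement holds when `Π^tp` is replaced by `Π`»), Lem. 2.17 (ii) p. 58 (discrete normalisers
`N_{Π̂}(H) = N_Π(H)`) [cite: MochizukiEtTh2009, Prop 2.6 p.40]. Cell abc-iut, layer L2, cone node EtTh:Prop2.6, seat
abc-iut-w6-d084 (gen 6; author of `TemperedCoverData.prop26_of_core`, `Discharge/Sec2Prop26Reduction`), L2-lead menu
row R788 (M8) «EtTh:Cor2.9 / Prop2.6 ⟸ F-0610». PROOF-ONLY companion (0 definitions, no instance, no new `Prop`) of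
abc-iut-L2-t2's `ThetaCoversTempered.lean` (`TemperedCoverData.Prop24`, `.Prop26`, `.Prop26_profinite`,
`.ExtendsStabilising`).

WHAT IS PROVED — pure topological group theory over a profinite completion `ι : F → F̂` (abc-iut-L3's frozen
`SemiGraphs.IsProfiniteCompletion`) with `F̂` SLIM (`Frobenioids.IsSlimGroup`):

* `apply_eq_hatConj_of_extends` — if a topological automorphism `γ` of an open finite-index subgroup `H ≤ F` is
  «conjugation by `ĝ ∈ F̂`» read through `ι` (`ι(γ h) = ĝ·ι(h)·ĝ⁻¹`), then EVERY topological automorphism `Γ` of `F`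
  extending `γ` is conjugation by `ĝ` read through `ι` on ALL of `F`: `ι(Γ x) = ĝ·ι(x)·ĝ⁻¹`. (Extend `Γ` to `Γ̂ ∈ Aut(F̂)`
  by the universal property `IsProfiniteCompletion.exists_continuousMulEquiv_extending`; `Γ̂` and `Int(ĝ)` agree on
  the OPEN closure of `ι(H)`, hence coincide by abc-iut-L2-t7's `IsSlimGroup.continuousMulEquiv_eq_of_eqOn`.)
* `hatConj_mem_range_of_extends` / `not_exists_extends_of_hatConj_not_mem_range` — hence such a `γ` extends to `F`
  ONLY IF `ĝ` normalises `ι(F)`; one `x ∈ F` with `ĝ·ι(x)·ĝ⁻¹ ∉ ι(F)` kills every extension.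

Over `T : ThetaCovers.TemperedCoverData l` (`ι := toHat : Π^tp_C → Π_C`):

* `not_extendsStabilising_of_hatConj`, **`not_prop26_of_hatConj`**, **`not_prop24_of_hatConj`** — with `Π_C` slim,
  ONE dotted (resp. undotted) member `Π^tp_Ż` (resp. `Π^tp_Z`) carrying ONE automorphism «conjugation by `ĝ ∈ Π_C`» with
  `ĝ` NOT normalising `toHat(Π^tp_C)` refutes the typed Prop. 2.6 (resp. Prop. 2.4) at `T`;
* **`hatConj_mem_range_of_prop26`** (and `…_of_prop24`) — the contrapositive as a NECESSARY CONDITION: at a datum with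
  slim `Π_C`, the typed `Prop26` forces every `ĝ ∈ Π_C` whose conjugation restricts to a topological automorphism of a
  dotted member to normalise `toHat(Π^tp_C)` — a discrete-normaliser property of the kind of [EtTh] Lem. 2.17 (ii)
  (in print a THEOREM about tempered fundamental groups of hyperbolic orbicurves; the interface does not carry it);
* `not_prop26_profinite_of_hatConj` — the profinite clause: if `ĝ ∈ Π_C` normalises the closure `Π_Ż` of a dotted
  member but NOT the closure of the undotted member (or of `Π^tp_Ċ`), then `Prop26_profinite` fails (any extension of
  `Int(ĝ)|Π_Ż` to `Π_C` IS `Int(ĝ)` by slimness).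

This is exactly the mechanism of abc-iut-f-151's refutation at the κ′ cover datum
(`SettingModel.not_prop26_temperedCoverData_inversionModelκ'`: `ĝ = â^{N s}`, `(s^N)² ∉ ℤ`, `Π_C` slim), stated once
over the interface so that deciding `Prop24`/`Prop26` at any further datum (e.g. abc-iut-L2-t10's χ′ section cover
`temperedCoverDataInvχ'`) reduces to: slimness of `Π_C` + ONE exotic normalising element.

HONEST FRAMING: statements about OUR typed one-object forms over the abstract interface; nothing here asserts or
denies [EtTh] Prop. 2.4 / 2.6 (there: genuine tempered fundamental groups, where Lem. 2.17 (ii) holds); FACT rows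
F-0609/F-0610/F-0611 untouched as labels; no side is taken on [IUTchIII] Cor. 3.12; typed ≠ proved.
-/

namespace Literature.AnabelianGeometry.EtaleTheta

namespace ThetaCovers

open Literature.AlgebraicGeometry.Frobenioids (IsSlimGroup)
open Literature.AnabelianGeometry.SemiGraphs
open _root_.Topology

universe u v

/-! ### §1. Over a profinite completion `ι : F → F̂` with `F̂` slim -/

section Completion

variable {F : Type u} {Fhat : Type v} [Group F] [TopologicalSpace F] [IsTopologicalGroup F]
  [Group Fhat] [TopologicalSpace Fhat] [IsTopologicalGroup Fhat] {ι : F →ₜ* Fhat}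

/-- **An extension of a profinite conjugation is that conjugation.** Let `ι : F → F̂` be a profinite completion
with `F̂` slim, `H ≤ F` open of finite index, `γ ∈ Aut(H)` with `ι(γ h) = ĝ·ι(h)·ĝ⁻¹` (`ĝ ∈ F̂`). Then every
topological automorphism `Γ` of `F` restricting to `γ` satisfies `ι(Γ x) = ĝ·ι(x)·ĝ⁻¹` for ALL `x ∈ F` — the
extension `Γ̂` of `Γ` to `F̂` agrees with `Int(ĝ)` on the open closure of `ι(H)`, so equals it (slimness).
[cite: MochizukiEtTh2009, Prop 2.6 p.40] -/
theorem apply_eq_hatConj_of_extends (hι : IsProfiniteCompletion ι) (hslim : IsSlimGroup Fhat)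
    {H : Subgroup F} (hHo : IsOpen (H : Set F)) [H.FiniteIndex]
    (γ : H ≃ₜ* H) (ĝ : Fhat) (hγ : ∀ h : H, ι (γ h) = ĝ * ι h * ĝ⁻¹)
    (Γ : F ≃ₜ* F) (hΓ : ∀ h : H, Γ h = γ h) (x : F) : ι (Γ x) = ĝ * ι x * ĝ⁻¹ := by
  haveI := hι.t2Space
  obtain ⟨Γhat, hΓhat⟩ := hι.exists_continuousMulEquiv_extending Γ
  -- conjugation by `ĝ` as a topological automorphism of `F̂`
  let C : Fhat ≃ₜ* Fhat := ContinuousMulEquiv.mk (MulAut.conj ĝ)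
    (show Continuous fun y : Fhat => ĝ * y * ĝ⁻¹ by fun_prop)
    (show Continuous fun y : Fhat => ĝ⁻¹ * y * ĝ by fun_prop)
  have hC : ∀ y : Fhat, C y = ĝ * y * ĝ⁻¹ := fun y => rfl
  -- `Γ̂` and `C` agree on `ι(H)` …
  have hsub : ((H.map ι.toMonoidHom : Subgroup Fhat) : Set Fhat) ⊆ {y : Fhat | Γhat y = C y} := by
    rintro _ ⟨h, hh, rfl⟩
    show Γhat (ι h) = C (ι h)
    rw [hC, hΓhat]
    have h1 : Γ h = γ ⟨h, hh⟩ := hΓ ⟨h, hh⟩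
    change ι (Γ h) = _
    rw [h1, hγ ⟨h, hh⟩]
  -- … hence on its closure, which is OPEN in `F̂`
  have hagree : ∀ y ∈ (H.map ι.toMonoidHom).topologicalClosure, Γhat y = C y := by
    intro y hy
    have hcl : IsClosed {y : Fhat | Γhat y = C y} := isClosed_eq Γhat.continuous C.continuous
    have hy' : y ∈ closure ((H.map ι.toMonoidHom : Subgroup Fhat) : Set Fhat) := by
      rwa [← Subgroup.topologicalClosure_coe]
    exact closure_minimal hsub hcl hy'
  have hopen := hι.isOpen_topologicalClosure_map H hHo
  have hEq : Γhat = C := hslim.continuousMulEquiv_eq_of_eqOn hopen Γhat C hagree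
  have hx := hΓhat x
  rw [hEq, hC] at hx
  exact hx.symm

/-- **Necessary condition for extension**: if the profinite conjugation `γ = Int(ĝ)|_H` extends to a topological
automorphism of `F`, then `ĝ` normalises `ι(F)`: `ĝ·ι(x)·ĝ⁻¹ ∈ ι(F)` for every `x` (indeed `= ι(Γ x)`).
[cite: MochizukiEtTh2009, Lem 2.17 (ii) p.58] -/
theorem hatConj_mem_range_of_extends (hι : IsProfiniteCompletion ι) (hslim : IsSlimGroup Fhat)
    {H : Subgroup F} (hHo : IsOpen (H : Set F)) [H.FiniteIndex]
    (γ : H ≃ₜ* H) (ĝ : Fhat) (hγ : ∀ h : H, ι (γ h) = ĝ * ι h * ĝ⁻¹)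
    (Γ : F ≃ₜ* F) (hΓ : ∀ h : H, Γ h = γ h) (x : F) : ĝ * ι x * ĝ⁻¹ ∈ Set.range ι :=
  ⟨Γ x, apply_eq_hatConj_of_extends hι hslim hHo γ ĝ hγ Γ hΓ x⟩

/-- **No extension**: if `ĝ·ι(x)·ĝ⁻¹ ∉ ι(F)` for ONE `x ∈ F`, then the profinite conjugation `γ = Int(ĝ)|_H` is the
restriction of NO topological automorphism of `F`. [cite: MochizukiEtTh2009, Prop 2.6 p.40] -/
theorem not_exists_extends_of_hatConj_not_mem_range (hι : IsProfiniteCompletion ι) (hslim : IsSlimGroup Fhat)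
    {H : Subgroup F} (hHo : IsOpen (H : Set F)) [H.FiniteIndex]
    (γ : H ≃ₜ* H) (ĝ : Fhat) (hγ : ∀ h : H, ι (γ h) = ĝ * ι h * ĝ⁻¹)
    {x : F} (hx : ĝ * ι x * ĝ⁻¹ ∉ Set.range ι) :
    ¬ ∃ Γ : F ≃ₜ* F, ∀ h : H, Γ h = γ h := by
  rintro ⟨Γ, hΓ⟩
  exact hx (hatConj_mem_range_of_extends hι hslim hHo γ ĝ hγ Γ hΓ x)

end Completion

/-! ### §2. Over the interface `ThetaCovers.TemperedCoverData` (`ι := toHat : Π^tp_C → Π_C`) -/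

namespace TemperedCoverData

variable {l : ℕ} (T : TemperedCoverData.{u} l)

/-- `toHat : Π^tp_C → Π_C` as a continuous homomorphism is a profinite completion (the interface field, repackaged
so that the §1 lemmas apply verbatim). [cite: MochizukiEtTh2009, Prop 2.4 p.38] -/
theorem isProfiniteCompletion_toHatCont :
    IsProfiniteCompletion (⟨T.toHat, T.continuous_toHat⟩ : T.Gtp →ₜ* T.PiC) :=
  T.isProfiniteCompletion_toHat

/-- **No `ExtendsStabilising` for an exotic profinite conjugation** (any list `L`): with `Π_C` slim, an automorphism
of an open finite-index `H ≤ Π^tp_C` that is `toHat`-conjugation by some `ĝ ∈ Π_C` NOT normalising `toHat(Π^tp_C)`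
does not extend to `Π^tp_C` at all. [cite: MochizukiEtTh2009, Prop 2.4 p.38] -/
theorem not_extendsStabilising_of_hatConj (hslim : IsSlimGroup T.PiC) {H : Subgroup T.Gtp}
    (hHo : IsOpen (H : Set T.Gtp)) [H.FiniteIndex] (γ : H ≃ₜ* H) (ĝ : T.PiC)
    (hγ : ∀ h : H, T.toHat (γ h) = ĝ * T.toHat h * ĝ⁻¹) {x : T.Gtp}
    (hx : ĝ * T.toHat x * ĝ⁻¹ ∉ Set.range T.toHat) (L : List (Subgroup T.Gtp)) :
    ¬ T.ExtendsStabilising H γ L := by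
  rintro ⟨Γ, hΓ, -⟩
  exact not_exists_extends_of_hatConj_not_mem_range (ι := ⟨T.toHat, T.continuous_toHat⟩)
    T.isProfiniteCompletion_toHatCont hslim hHo γ ĝ hγ hx ⟨Γ, hΓ⟩

/-- **[EtTh] Prop. 2.6 AS TYPED fails at any datum with slim `Π_C` and ONE exotic profinite conjugation of a dotted
member**: `Z` one of `Π^tp_{X̲̲}, Π^tp_{X̲}, Π^tp_{C̲̲}, Π^tp_{C̲}`, `γ ∈ Aut(Π^tp_Ż)` (`Π^tp_Ż = Π^tp_Z ∩ Π^tp_Ċ`) with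
`toHat(γ h) = ĝ·toHat(h)·ĝ⁻¹`, and `ĝ·toHat(x)·ĝ⁻¹ ∉ toHat(Π^tp_C)` for some `x`. (The mechanism of abc-iut-f-151's κ′
refutation, over the interface.) [cite: MochizukiEtTh2009, Prop 2.6 p.40] -/
theorem not_prop26_of_hatConj (hslim : IsSlimGroup T.PiC) {Z : Subgroup T.Gtp}
    (hZ : Z ∈ [T.tp T.PiXuu, T.tp T.PiXu, T.tp T.PiCuu, T.tp T.PiCu])
    (γ : ↥(Z ⊓ T.PiCdot) ≃ₜ* ↥(Z ⊓ T.PiCdot)) (ĝ : T.PiC)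
    (hγ : ∀ h : ↥(Z ⊓ T.PiCdot), T.toHat (γ h) = ĝ * T.toHat h * ĝ⁻¹) {x : T.Gtp}
    (hx : ĝ * T.toHat x * ĝ⁻¹ ∉ Set.range T.toHat) : ¬ T.Prop26 := by
  intro h26
  haveI := T.finiteIndex_inf_PiCdot_of_mem_four hZ
  exact T.not_extendsStabilising_of_hatConj hslim (T.isOpen_inf_PiCdot_of_mem_four hZ) γ ĝ hγ hx _ (h26 Z hZ γ)

/-- **[EtTh] Prop. 2.4 AS TYPED fails at any datum with slim `Π_C` and ONE exotic profinite conjugation of an undotted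
member** `Z ∈ {Π^tp_{X̲̲}, Π^tp_{X̲}, Π^tp_{C̲̲}, Π^tp_{C̲}}` (member-agnostic form for the holder of cone node
EtTh:Prop2.4). [cite: MochizukiEtTh2009, Prop 2.4 p.38] -/
theorem not_prop24_of_hatConj (hslim : IsSlimGroup T.PiC) {Z : Subgroup T.Gtp}
    (hZ : Z ∈ [T.tp T.PiXuu, T.tp T.PiXu, T.tp T.PiCuu, T.tp T.PiCu])
    (γ : Z ≃ₜ* Z) (ĝ : T.PiC) (hγ : ∀ h : Z, T.toHat (γ h) = ĝ * T.toHat h * ĝ⁻¹) {x : T.Gtp}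
    (hx : ĝ * T.toHat x * ĝ⁻¹ ∉ Set.range T.toHat) : ¬ T.Prop24 := by
  rintro ⟨h1, h2, h3, h4⟩
  haveI := T.finiteIndex_of_mem_four hZ
  have hZo := T.isOpen_of_mem_four hZ
  simp only [List.mem_cons, List.mem_nil_iff, or_false] at hZ
  rcases hZ with rfl | rfl | rfl | rfl
  · exact T.not_extendsStabilising_of_hatConj hslim hZo γ ĝ hγ hx _ (h1 γ)
  · exact T.not_extendsStabilising_of_hatConj hslim hZo γ ĝ hγ hx _ (h2 γ)
  · exact T.not_extendsStabilising_of_hatConj hslim hZo γ ĝ hγ hx _ (h3 γ)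
  · exact T.not_extendsStabilising_of_hatConj hslim hZo γ ĝ hγ hx _ (h4 γ)

/-- **What the typed Prop. 2.6 FORCES at a datum with slim `Π_C`** (necessary condition, the contrapositive of
`not_prop26_of_hatConj`): every `ĝ ∈ Π_C` whose conjugation restricts — through `toHat` — to a topological
automorphism of a dotted member `Π^tp_Ż` NORMALISES `toHat(Π^tp_C)`. A discrete-normaliser property of the type of
[EtTh] Lem. 2.17 (ii) («`N_{Π̂}(H) = N_Π(H)`», a theorem for tempered fundamental groups of hyperbolic orbicurves) that
the abstract interface does not carry. [cite: MochizukiEtTh2009, Lem 2.17 (ii) p.58] -/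
theorem hatConj_mem_range_of_prop26 (hslim : IsSlimGroup T.PiC) (h26 : T.Prop26) {Z : Subgroup T.Gtp}
    (hZ : Z ∈ [T.tp T.PiXuu, T.tp T.PiXu, T.tp T.PiCuu, T.tp T.PiCu])
    (γ : ↥(Z ⊓ T.PiCdot) ≃ₜ* ↥(Z ⊓ T.PiCdot)) (ĝ : T.PiC)
    (hγ : ∀ h : ↥(Z ⊓ T.PiCdot), T.toHat (γ h) = ĝ * T.toHat h * ĝ⁻¹) (x : T.Gtp) :
    ĝ * T.toHat x * ĝ⁻¹ ∈ Set.range T.toHat := by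
  by_contra hx
  exact T.not_prop26_of_hatConj hslim hZ γ ĝ hγ hx h26

/-- The same necessary condition forced by the typed Prop. 2.4 (undotted members).
[cite: MochizukiEtTh2009, Lem 2.17 (ii) p.58] -/
theorem hatConj_mem_range_of_prop24 (hslim : IsSlimGroup T.PiC) (h24 : T.Prop24) {Z : Subgroup T.Gtp}
    (hZ : Z ∈ [T.tp T.PiXuu, T.tp T.PiXu, T.tp T.PiCuu, T.tp T.PiCu])
    (γ : Z ≃ₜ* Z) (ĝ : T.PiC) (hγ : ∀ h : Z, T.toHat (γ h) = ĝ * T.toHat h * ĝ⁻¹) (x : T.Gtp) :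
    ĝ * T.toHat x * ĝ⁻¹ ∈ Set.range T.toHat := by
  by_contra hx
  exact T.not_prop24_of_hatConj hslim hZ γ ĝ hγ hx h24

/-- **Under the typed Prop. 2.6 the extension of a profinite conjugation is conjugation**: if `Γ` extends
`γ = Int(ĝ)|Π^tp_Ż` (slim `Π_C`), then `toHat ∘ Γ = Int(ĝ) ∘ toHat` on all of `Π^tp_C`; in particular `Γ` is UNIQUE
(cf. abc-iut-L2-t7's `prop26_existsUnique` under temp-slimness of `Π^tp_C` — here slimness of the PROFINITE `Π_C`
suffices for these `γ`). [cite: MochizukiEtTh2009, Prop 2.6 p.40] -/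
theorem toHat_apply_eq_hatConj_of_extends (hslim : IsSlimGroup T.PiC) {Z : Subgroup T.Gtp}
    (hZ : Z ∈ [T.tp T.PiXuu, T.tp T.PiXu, T.tp T.PiCuu, T.tp T.PiCu])
    (γ : ↥(Z ⊓ T.PiCdot) ≃ₜ* ↥(Z ⊓ T.PiCdot)) (ĝ : T.PiC)
    (hγ : ∀ h : ↥(Z ⊓ T.PiCdot), T.toHat (γ h) = ĝ * T.toHat h * ĝ⁻¹)
    (Γ : T.Gtp ≃ₜ* T.Gtp) (hΓ : ∀ h : ↥(Z ⊓ T.PiCdot), Γ h = γ h) (x : T.Gtp) :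
    T.toHat (Γ x) = ĝ * T.toHat x * ĝ⁻¹ := by
  haveI := T.finiteIndex_inf_PiCdot_of_mem_four hZ
  exact apply_eq_hatConj_of_extends (ι := ⟨T.toHat, T.continuous_toHat⟩) T.isProfiniteCompletion_toHatCont hslim
    (T.isOpen_inf_PiCdot_of_mem_four hZ) γ ĝ hγ Γ hΓ x

/-! ### §3. The profinite clause `Prop26_profinite` -/

/-- **The profinite clause of Prop. 2.6 AS TYPED fails for a normalising-but-not-stabilising element**: with `Π_C`
slim, if `ĝ ∈ Π_C` normalises the closure `Π_Ż` of `toHat(Π^tp_Ż)` (so that `Int(ĝ)` restricts to a topological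
automorphism `γ` of `Π_Ż`) but `Int(ĝ)` does NOT stabilise the closure of `toHat(S)` for some `S ∈ {Π^tp_Z, Π^tp_Ċ}`,
then `Prop26_profinite` fails: any extension of `γ` to `Π_C` agrees with `Int(ĝ)` on the open `Π_Ż`, hence IS `Int(ĝ)`.
[cite: MochizukiEtTh2009, Prop 2.6 p.40] -/
theorem not_prop26_profinite_of_hatConj (hslim : IsSlimGroup T.PiC) {Z : Subgroup T.Gtp}
    (hZ : Z ∈ [T.tp T.PiXuu, T.tp T.PiXu, T.tp T.PiCuu, T.tp T.PiCu]) (ĝ : T.PiC)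
    (γ : ((Z ⊓ T.PiCdot).map T.toHat).topologicalClosure ≃ₜ* ((Z ⊓ T.PiCdot).map T.toHat).topologicalClosure)
    (hγ : ∀ y : ((Z ⊓ T.PiCdot).map T.toHat).topologicalClosure, (γ y : T.PiC) = ĝ * y * ĝ⁻¹)
    {S : Subgroup T.Gtp} (hS : S ∈ [Z, T.PiCdot])
    (hbad : ((S.map T.toHat).topologicalClosure).map (MulAut.conj ĝ).toMonoidHom ≠
      (S.map T.toHat).topologicalClosure) :
    ¬ T.Prop26_profinite := by
  intro h
  haveI := T.isProfiniteCompletion_toHat.t2Space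
  haveI := T.finiteIndex_inf_PiCdot_of_mem_four hZ
  obtain ⟨Γ, hΓ, hst⟩ := h Z hZ γ
  -- `Γ` agrees with `Int(ĝ)` on the open `Π_Ż`, hence equals it
  let C : T.PiC ≃ₜ* T.PiC := ContinuousMulEquiv.mk (MulAut.conj ĝ)
    (show Continuous fun y : T.PiC => ĝ * y * ĝ⁻¹ by fun_prop)
    (show Continuous fun y : T.PiC => ĝ⁻¹ * y * ĝ by fun_prop)
  have hC : ∀ y : T.PiC, C y = ĝ * y * ĝ⁻¹ := fun y => rfl
  have hopen := T.isOpen_closure_map_toHat (Z ⊓ T.PiCdot) (T.isOpen_inf_PiCdot_of_mem_four hZ)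
  have hEq : Γ = C := hslim.continuousMulEquiv_eq_of_eqOn hopen Γ C fun y hy => by
    rw [hC, hΓ ⟨y, hy⟩, hγ ⟨y, hy⟩]
  have hS' : S ∈ [Z ⊓ T.PiCdot, Z, T.PiCdot] := by
    simp only [List.mem_cons, List.mem_nil_iff, or_false] at hS ⊢
    tauto
  have h1 := hst S hS'
  rw [hEq] at h1
  exact hbad h1

end TemperedCoverData

end ThetaCovers

end Literature.AnabelianGeometry.EtaleTheta
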